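import Mathlib
import HarnessLib
import Summits.NavierStokesRegularity.NavierStokesRegularity.Theorems.PoloidalWindowDoorLrcModEntireSlopeSmooth
import Summits.NavierStokesRegularity.NavierStokesRegularity.Theorems.PoloidalWindowDoorLrcModEntireQ4SonicSheetDataPackage
import Summits.NavierStokesRegularity.NavierStokesRegularity.Theorems.PoloidalWindowDoorPoloidalWindowRigidityLeafUniformHFlat
import Summits.NavierStokesRegularity.NavierStokesRegularity.Theorems.PoloidalWindowDoorLrcModEntireRidgeWebDynamics

/-!
# Route `PoloidalWindowDoor`, item `LrcModEntire` (stmt-NavierStokesRegularity-20428), cell (Q4-sonic), slot `stub_Q4sonicLineNeg`, case I —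
# B4: ON THE CASE-I BOX THE (TH) SLOPE IS `C^∞` AND `≠ 1` (discharging the `μ`-hypotheses of `…CaseISfreeBranch.caseI_sfree_false`)

Cell ns-regularity-ideate, helper seat ns-k2-port-2 g8 under the LEAD of item 20428 (ns-poloidal-K2-p3 g17); `--supports stmt-NavierStokesRegularity-20428 --as helper`.

* ★ `slope_smooth_on_box` — class profile, slab law, the output block of `…Q4TimeWebPackage.time_web_package_line` (ridge law `σ(D²U₂[e,e] + D²U₂[Je,Je]) = −κ < 0`
  at web points) ⊢ `uncurry μ ∈ C^∞` on the box `{(t,z) : |t+1| < δ′, |z| < δ′}`: at the web point over `(τ, 0, z)` one of `D²U₂[e,e]`, `D²U₂[Je,Je]` is non-zero,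
  so the corresponding horizontal derivative of `U₂` is non-zero somewhere on the line `W + ℝv` inside the plane `{x₂ = z}`, and `…SlopeSmooth` applies.
* ★ `slope_ne_one_on_box` — with CASE I on the box (`hsonI`, `hparI`): `μ(t,z) = −d_z² ≤ 0`, in particular `μ(t,z) ≠ 1` (`…Q4SonicSheetDataPackage` (ii)).
WHAT THIS IS NOT: not a claim about Navier–Stokes regularity; no stub is closed here; items 20428 / 19708 / 27893 OPEN.
-/

noncomputable section

set_option linter.dupNamespace false
set_option linter.style.longLine false

namespace Summit.NavierStokesRegularity.NavierStokesRegularity.Theorems.PoloidalWindowDoorLrcModEntireSlopeBox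

open Set Function Filter Topology Metric
open scoped RealInnerProductSpace InnerProductSpace ContDiff
open Literature.Analysis
open Summit.NavierStokesRegularity.NavierStokesRegularity.Theorems.LocalSineTubeDoorProfileAlignedWindowRigidityAncient
open Summit.NavierStokesRegularity.NavierStokesRegularity.Theorems.PoloidalWindowDoorPoloidalWindowRigidityWindow
open Summit.NavierStokesRegularity.NavierStokesRegularity.Theorems.PoloidalWindowDoorLrcModEntireSheetFlattenTools
open Summit.NavierStokesRegularity.NavierStokesRegularity.Theorems.PoloidalWindowDoorLrcModEntireShearedKinematics
open Summit.NavierStokesRegularity.NavierStokesRegularity.Theorems.PoloidalWindowDoorLrcModEntireSlopeSmooth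
open Summit.NavierStokesRegularity.NavierStokesRegularity.Theorems.PoloidalWindowDoorLrcModEntireQ4SonicSheetDataPackage
open Summit.NavierStokesRegularity.NavierStokesRegularity.Theorems.PoloidalWindowDoorLrcModEntireQ4SonicHotSheetSecondPins
open Summit.NavierStokesRegularity.NavierStokesRegularity.Theorems.PoloidalWindowDoorLrcModEntireRidgeWebDynamics

variable {C : ℝ} {U : ℝ → E3 → E3} {R μ : ℝ → ℝ → ℝ} {σ r ρ δ' : ℝ} {e : E3} {n₀ : ℝ × ℝ × ℝ → ℝ} {κt : ℝ → ℝ → ℝ}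

/-- If `r ↦ D θ(W + r v)[v]` vanishes for every `r`, then `D²θ(W)[v][v] = 0` (`θ ∈ C²`). -/
theorem secondDeriv_eq_zero_of_line {θ : E3 → ℝ} (hθ : ContDiff ℝ 2 θ) (W v : E3)
    (h : ∀ r : ℝ, fderiv ℝ θ (W + r • v) v = 0) : fderiv ℝ (fderiv ℝ θ) W v v = 0 := by
  have hD : Differentiable ℝ (fderiv ℝ θ) := (hθ.fderiv_right (m := 1) (by norm_num)).differentiable (by norm_num)
  have hL : HasDerivAt (fun r : ℝ => W + r • v) v 0 := by
    have h1 := ((hasDerivAt_id (0 : ℝ)).smul_const v).const_add W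
    simpa using h1
  have hd : DifferentiableAt ℝ (fun x : E3 => fderiv ℝ θ x v) (W + (0 : ℝ) • v) := by
    rw [zero_smul, add_zero]; exact (hD W).clm_apply (differentiableAt_const v)
  have hc := hd.hasFDerivAt.comp_hasDerivAt (0 : ℝ) hL
  have hval : fderiv ℝ (fun x : E3 => fderiv ℝ θ x v) (W + (0 : ℝ) • v) v = fderiv ℝ (fderiv ℝ θ) W v v := by
    rw [zero_smul, add_zero, fderiv_partial_apply' (hD W)]
  rw [hval] at hc
  have hzero : HasDerivAt (fun r : ℝ => fderiv ℝ θ (W + r • v) v) 0 0 := by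
    have hf : (fun r : ℝ => fderiv ℝ θ (W + r • v) v) = fun _ => 0 := funext h
    rw [hf]; exact hasDerivAt_const 0 0
  exact hc.unique hzero

/-- ★ **`uncurry μ ∈ C^∞` on the case-I box** (from the ridge law of the space–time web package; no case-I literal needed). -/
theorem slope_smooth_on_box
    (hrate : FluidPDE.HasTypeITimeDecay C U) (hcont : ContinuousOn (uncurry U) (Iio (0 : ℝ) ×ˢ univ))
    (hmild : ∀ s t : ℝ, s < t → t < 0 → ∀ x, U t x = UnboundedOperators.heatExtension (U s) (t - s) x - FluidPDE.oseenDuhamel 1 s U U t x)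
    (hdiv : ∀ t < 0, FluidPDE.VectorCalculus.IsDivFree (U t))
    (hslabU : ∀ t : ℝ, |t + 1| < ρ → ∀ x : E3, |x 2| < ρ → ∀ b : Fin 3, b ≠ 2 →
      fderiv ℝ (U t) x (EuclideanSpace.single 2 1) b = μ t (x 2) * fderiv ℝ (U t) x (EuclideanSpace.single b 1) 2)
    (hδ'ρ : δ' ≤ ρ) (hδ'h : δ' < 1 / 2) (he2 : e 2 = 0)
    (hpack : ∀ q : ℝ × ℝ × ℝ, |q.1| < δ' → |q.2.2| < δ' →
        n₀ q ∈ Ioo (-r) r ∧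
        σ * U (-1 + q.1) (frameCLM e (q.2.1, n₀ q, q.2.2)) 2 = R q.1 q.2.2 ∧
        (∀ n ∈ Icc (-r) r, n ≠ n₀ q → σ * U (-1 + q.1) (frameCLM e (q.2.1, n, q.2.2)) 2 < R q.1 q.2.2) ∧
        (∀ w : E3, w 2 = 0 → fderiv ℝ (fun y => U (-1 + q.1) y 2) (frameCLM e (q.2.1, n₀ q, q.2.2)) w = 0) ∧
        (∀ m : ℕ∞, ContDiffAt ℝ m n₀ q) ∧
        0 < κt q.1 q.2.2 ∧
        fderiv ℝ (fderiv ℝ (fun y => σ * U (-1 + q.1) y 2)) (frameCLM e (q.2.1, n₀ q, q.2.2)) e e +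
            fderiv ℝ (fderiv ℝ (fun y => σ * U (-1 + q.1) y 2)) (frameCLM e (q.2.1, n₀ q, q.2.2)) (Jvec e) (Jvec e) =
          -κt q.1 q.2.2 ∧
        κt q.1 q.2.2 * (fderiv ℝ n₀ q ((0 : ℝ), (0 : ℝ), (1 : ℝ))) ^ 2 =
          (deriv (deriv (R q.1)) q.2.2 - μ (-1 + q.1) q.2.2 * κt q.1 q.2.2) * (1 + (fderiv ℝ n₀ q ((0 : ℝ), (1 : ℝ), (0 : ℝ))) ^ 2)) :
    ContDiffOn ℝ ∞ (uncurry μ) {q : ℝ × ℝ | |q.1 + 1| < δ' ∧ |q.2| < δ'} := by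
  intro q hq
  obtain ⟨hqt, hqz⟩ := hq
  set t : ℝ := q.1 with ht_def
  set z : ℝ := q.2 with hz_def
  set τ : ℝ := t + 1 with hτ_def
  have hτ : |τ| < δ' := hqt
  have hτt : -1 + τ = t := by rw [hτ_def]; ring
  have ht0 : t < 0 := by have h := (abs_lt.1 hqt).2; linarith [hδ'h]
  have htρ : |t + 1| < ρ := lt_of_lt_of_le hqt hδ'ρ
  -- the web point over `(τ, 0, z)` and the ridge law there
  obtain ⟨-, -, -, -, -, hκ, hridge, -⟩ := hpack (τ, (0 : ℝ), z) hτ hqz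
  simp only at hκ hridge
  rw [hτt] at hridge
  set W : E3 := frameCLM e ((0 : ℝ), n₀ (τ, (0 : ℝ), z), z) with hW
  have hW2 : W 2 = z := by rw [hW, frameCLM_apply_two he2]
  -- regularity of the slice
  have hA := isTypeIAncientMild_of_class hrate hcont hmild hdiv
  have hT : IsOpen (Iio (0 : ℝ)) := isOpen_Iio
  have hWs : ContDiffOn ℝ ∞ (uncurry U) (Iio 0 ×ˢ (univ : Set E3)) := hA.contDiffOn
  have hsl : ContDiff ℝ ∞ (U t) := hA.contDiff_slice ht0
  set θ : E3 → ℝ := fun y => U t y 2 with hθ_def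
  have hθ : ContDiff ℝ ∞ θ := (contDiff_piLp_apply (p := 2) (𝕜 := ℝ) (E := fun _ : Fin 3 => ℝ) (i := (2 : Fin 3))).comp hsl
  have hθ2 : ContDiff ℝ 2 θ := hθ.of_le (by norm_cast)
  have hUd : Differentiable ℝ (U t) := hsl.differentiable (by simp)
  have hcoord : ∀ x w : E3, fderiv ℝ (U t) x w 2 = fderiv ℝ θ x w := fun x w => by
    have h := ((EuclideanSpace.proj (𝕜 := ℝ) (2 : Fin 3)).hasFDerivAt.comp x (hUd x).hasFDerivAt).fderiv
    have e3 : (⇑(EuclideanSpace.proj (𝕜 := ℝ) (2 : Fin 3)) ∘ U t) = θ := by funext y; simp [hθ_def]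
    rw [e3] at h
    rw [h]; rfl
  -- one of `D²θ(W)[e,e]`, `D²θ(W)[Je,Je]` is non-zero
  rw [fderiv_fderiv_const_mul_apply hθ2 σ W e e, fderiv_fderiv_const_mul_apply hθ2 σ W (Jvec e) (Jvec e)] at hridge
  have hne : fderiv ℝ (fderiv ℝ θ) W e e ≠ 0 ∨ fderiv ℝ (fderiv ℝ θ) W (Jvec e) (Jvec e) ≠ 0 := by
    by_contra h
    rw [not_or, not_ne_iff, not_ne_iff] at h
    rw [h.1, h.2] at hridge
    linarith
  -- hence some horizontal derivative of `θ` is non-zero at a point of the plane `{x₂ = z}`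
  have key : ∀ v : E3, v 2 = 0 → fderiv ℝ (fderiv ℝ θ) W v v ≠ 0 →
      ∃ x : E3, x 2 = z ∧ ∃ b : Fin 3, b ≠ 2 ∧ fderiv ℝ (U t) x (EuclideanSpace.single b 1) 2 ≠ 0 := by
    intro v hv2 hvv
    have hex : ∃ r' : ℝ, fderiv ℝ θ (W + r' • v) v ≠ 0 := by
      by_contra hall
      simp only [not_exists, not_not] at hall
      exact hvv (secondDeriv_eq_zero_of_line hθ2 W v hall)
    obtain ⟨r', hr'⟩ := hex
    refine ⟨W + r' • v, by simp [hW2, hv2], ?_⟩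
    -- `Dθ[v] = v₀∂₀θ + v₁∂₁θ` (since `v₂ = 0`), so some `∂_bθ ≠ 0`
    have hdec : v = v 0 • EuclideanSpace.single 0 (1 : ℝ) + v 1 • EuclideanSpace.single 1 (1 : ℝ) :=
      PoloidalWindowDoorPoloidalWindowRigidityLeafUniformHFlat.horizontal_decomp' hv2
    set P : E3 := W + r' • v with hP
    have hlin : fderiv ℝ θ P v = v 0 * fderiv ℝ θ P (EuclideanSpace.single 0 (1 : ℝ)) + v 1 * fderiv ℝ θ P (EuclideanSpace.single 1 (1 : ℝ)) := by
      conv_lhs => rw [hdec]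
      rw [map_add, map_smul, map_smul, smul_eq_mul, smul_eq_mul]
    by_contra hnone
    simp only [not_exists, not_and, not_not] at hnone
    have h0 := hnone 0 (by decide)
    have h1 := hnone 1 (by decide)
    rw [hcoord] at h0 h1
    apply hr'
    rw [hlin, h0, h1, mul_zero, mul_zero, add_zero]
  obtain ⟨x, hx2, b, hb, hbx⟩ : ∃ x : E3, x 2 = z ∧ ∃ b : Fin 3, b ≠ 2 ∧ fderiv ℝ (U t) x (EuclideanSpace.single b 1) 2 ≠ 0 := by
    rcases hne with h | h
    · exact key e he2 h
    · exact key (Jvec e) (by simp [Jvec]) h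
  -- `…SlopeSmooth` at `(t, x)` with `T = {t' : |t'+1| < ρ} ∩ Iio 0`
  set T : Set ℝ := {t' : ℝ | |t' + 1| < ρ ∧ t' < 0} with hT_def
  have hTo : IsOpen T := (isOpen_lt (continuous_abs.comp (continuous_id.add continuous_const)) continuous_const).inter (isOpen_gt' 0)
  have hWT : ContDiffOn ℝ ∞ (uncurry U) (T ×ˢ (univ : Set E3)) := hWs.mono (prod_mono (fun t' ht' => ht'.2) Subset.rfl)
  have hslab : ∀ t' ∈ T, ∀ x' : E3, |x' 2| < ρ → ∀ b' : Fin 3, b' ≠ 2 →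
      fderiv ℝ (U t') x' (EuclideanSpace.single 2 1) b' = μ t' (x' 2) * fderiv ℝ (U t') x' (EuclideanSpace.single b' 1) 2 :=
    fun t' ht' x' hx' b' hb' => hslabU t' ht'.1 x' hx' b' hb'
  have hxρ : |x 2| < ρ := by rw [hx2]; exact lt_of_lt_of_le hqz hδ'ρ
  have h := slope_contDiffAt_of_horizDeriv_ne_zero hTo hWT hslab (t₀ := t) ⟨htρ, ht0⟩ hxρ hb hbx
  rw [hx2] at h
  exact h.contDiffWithinAt

/-- ★ **On the case-I box `μ = −d_z² ≤ 0`, in particular `μ ≠ 1`** (sonic + parallel at every time of the box). -/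
theorem slope_ne_one_on_box
    (hrate : FluidPDE.HasTypeITimeDecay C U) (hcont : ContinuousOn (uncurry U) (Iio (0 : ℝ) ×ˢ univ))
    (hmild : ∀ s t : ℝ, s < t → t < 0 → ∀ x, U t x = UnboundedOperators.heatExtension (U s) (t - s) x - FluidPDE.oseenDuhamel 1 s U U t x)
    (hdiv : ∀ t < 0, FluidPDE.VectorCalculus.IsDivFree (U t))
    (hσ : σ = 1 ∨ σ = -1) (hμ3 : ContDiff ℝ 3 (uncurry μ))
    (hslabU : ∀ t : ℝ, |t + 1| < ρ → ∀ x : E3, |x 2| < ρ → ∀ b : Fin 3, b ≠ 2 →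
      fderiv ℝ (U t) x (EuclideanSpace.single 2 1) b = μ t (x 2) * fderiv ℝ (U t) x (EuclideanSpace.single b 1) 2)
    (hδ'ρ : δ' ≤ ρ) (hδ'h : δ' < 1 / 2) (he2 : e 2 = 0) (hunit : e 0 ^ 2 + e 1 ^ 2 = 1)
    (hpack : ∀ q : ℝ × ℝ × ℝ, |q.1| < δ' → |q.2.2| < δ' →
        n₀ q ∈ Ioo (-r) r ∧
        σ * U (-1 + q.1) (frameCLM e (q.2.1, n₀ q, q.2.2)) 2 = R q.1 q.2.2 ∧
        (∀ n ∈ Icc (-r) r, n ≠ n₀ q → σ * U (-1 + q.1) (frameCLM e (q.2.1, n, q.2.2)) 2 < R q.1 q.2.2) ∧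
        (∀ w : E3, w 2 = 0 → fderiv ℝ (fun y => U (-1 + q.1) y 2) (frameCLM e (q.2.1, n₀ q, q.2.2)) w = 0) ∧
        (∀ m : ℕ∞, ContDiffAt ℝ m n₀ q) ∧
        0 < κt q.1 q.2.2 ∧
        fderiv ℝ (fderiv ℝ (fun y => σ * U (-1 + q.1) y 2)) (frameCLM e (q.2.1, n₀ q, q.2.2)) e e +
            fderiv ℝ (fderiv ℝ (fun y => σ * U (-1 + q.1) y 2)) (frameCLM e (q.2.1, n₀ q, q.2.2)) (Jvec e) (Jvec e) =
          -κt q.1 q.2.2 ∧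
        κt q.1 q.2.2 * (fderiv ℝ n₀ q ((0 : ℝ), (0 : ℝ), (1 : ℝ))) ^ 2 =
          (deriv (deriv (R q.1)) q.2.2 - μ (-1 + q.1) q.2.2 * κt q.1 q.2.2) * (1 + (fderiv ℝ n₀ q ((0 : ℝ), (1 : ℝ), (0 : ℝ))) ^ 2))
    (hsonI : ∀ τ : ℝ, |τ| < δ' → ∃ A B : ℝ, ∀ z : ℝ, |z| < δ' → R τ z = A + B * z)
    (hparI : ∀ τ s z : ℝ, |τ| < δ' → |z| < δ' → n₀ (τ, s, z) = n₀ (τ, (0 : ℝ), z))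
    {t z : ℝ} (ht : |t + 1| < δ') (hz : |z| < δ') : μ t z ≤ 0 ∧ μ t z ≠ 1 := by
  have hτt : -1 + (t + 1) = t := by ring
  obtain ⟨-, hQ0, -⟩ := sonic_sheet_data_of_package hrate hcont hmild hdiv hσ hμ3 hslabU hδ'ρ hδ'h he2 hunit hpack ht (hsonI (t + 1) ht)
    (fun s' z' hz' => hparI (t + 1) s' z' ht hz') 0 (z := z) hz
  rw [hτt] at hQ0
  have hle : μ t z ≤ 0 := by nlinarith [sq_nonneg (deriv (fun z' => n₀ (t + 1, (0 : ℝ), z')) z)]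
  exact ⟨hle, by linarith⟩

end Summit.NavierStokesRegularity.NavierStokesRegularity.Theorems.PoloidalWindowDoorLrcModEntireSlopeBox
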